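import Literature.IUT.LogThetaLattice.GlobalPacketsLGPMonoidsOfGaussian
import Literature.IUT.LogThetaLattice.TensorPacketsHermitian
import HarnessLib

/-!
# [IUTchIII] Proposition 3.4 (ii): the LGP-monoid construction at ALL places — the generic component-push
# constructor `LGPMonoidSignature.ofPush` and the ARCHIMEDEAN fibre `LGPMonoidSignature.ofGaussianArch`
# over the Hermitian tensor packets (`𝓘^ℚ` = the `ℚ`-span of the Hermitian unit ball, proved to be everything)

S. Mochizuki, *Inter-universal Teichmüller theory III*, kurims manuscript (May 2020) `paper:url-4b091feeb646`,
§3, Proposition 3.4 (ii) p. 102 l. 20 – p. 103 l. 24, Proposition 3.2 (ii) p. 99 [claim: Mochizuki2012,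
status: disputed] for every quoted sentence; abc-iut cell, layer L6, seat abc-iut-L6-t4 (typer of record of
[IUTchIII] §3; gen 4). Sequel of `GlobalPacketsLGPMonoidsOfGaussian.lean` (p422157: the NONARCHIMEDEAN fibre
`Vfib = {v ∣ p}`), which names as its residual "archimedean places (units clause of p. 103 l. 14–24 only;
Hermitian packets) are NOT built". Node IUTchIII:Prop3.4(ii), sub-DAG `plan/L6/SUBDAG-IUTchIII-Prop-34.md`
rows r14 / r17 (p. 103 l. 14–24: "For any `v ∈ 𝕍` [so also `v ∈ 𝕍^arc`], the component labeled `j` … of the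
submodule of Galois invariants [… this Galois action is trivial when `v ∈ 𝕍^arc`] of the unit portion
`Ψ_{𝓕LGP}(†𝓗𝓣^{Θ±ellNF})^×_v` … is a subset of `𝓘^ℚ(^{S^±_{j+1},j;‡}𝓕_v)` … that acts multiplicatively on
`𝓘^ℚ(^{S^±_{j+1},j;‡}𝓕_v)` [cf. … [IUTchII], Proposition 4.4, (iv)]").

WHAT IS BUILT.
* §1 `LGPMonoidSignature.ofPush` — the construction of the nonarchimedean file made GENERIC in the carriers:
  for any label-`j` carriers `R v j` with `𝓘^ℚ v j` EQUAL TO THE WHOLE CARRIER (hypothesis `hIQ`), any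
  †-side Gaussian data `gau / gauInf / split ⊆ ∏_{F_l^⋇} M_v` with `G_v`-action `Γ v` and any family of pushes
  `f v j : M_v →* R v j` ("(i) applied at the label `j` to the pull-backs", p. 102 l. 31–37), the output
  signature with components `pushComponent f v S j = f_{v,j}(pr_j S)`; `ofGaussian_eq_ofPush`: the landed
  nonarchimedean `LGPMonoidSignature.ofGaussian` (p422157) IS `ofPush` at `f := lgpPush` (by `rfl`);
* §2 `span_rat_hermitianBallAt_eq_top` — **at an archimedean `v_ℚ` the LITERAL `ℚ`-span of the Hermitian unit
  ball `𝓘(^{A,α}𝒟^⊢_v)` (Prop. 3.2 (ii) p. 99 "closed unit balls … may be regarded as integral structures on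
  the `ℚ`-spans `𝓘^ℚ(…)`"; abc-iut-w4-d039's genuine Hermitian inhabitant `hermitianBallAt A V r α v` of
  abc-iut-L6-t4's interface `ArchimedeanShellData`, `TensorPacketsHermitian.lean` p412100) is the WHOLE packet
  `log(^{A,α}𝒟^⊢_v) = ℂ_v ⊗_ℝ (⊗_{β≠α} ⊕_w ℂ_w)`** (radius `r ≠ 0`; `r = π` in print): the ball is absorbing
  (`B(c·t, c·t) = c²·B(t,t)`, Archimedean property of `ℝ`), and `n · (n⁻¹·t) = t` with `n ∈ ℕ ⊆ ℚ`;
* §3 the archimedean carriers `ArchLGPPacket v j := PacketAt ℝ (ArchComponents (Fin (j+1)) Varc) (Fin.last j) v`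
  (all `(j+1)`-capsule factors `ℂ_w`), `toArchLGPPacket`, `archLgpShellQ r v j :=` the `ℚ`-span of
  `hermitianBallAt … r …` (= ⊤, `archLgpShellQ_eq_top`), and **`LGPMonoidSignature.ofGaussianArch`** := `ofPush`
  at `f v j := toArchLGPPacket v j ∘ ι v` for ONE member `ι v : M_v →* ℂ` of the log-link's poly-isomorphism
  (EXPLICIT PARAMETER, as in the nonarchimedean file; the †-side arch Gaussian data of [IUTchII] Prop. 4.4
  (iv) / Cor. 4.6 (iv) are abc-iut-L6-t2 SLOTS `Prop44Statements.thetaGaussian`, so the inputs stay abstract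
  submonoids `gau v ⊆ ∏_{F_l^⋇} M_v`); "this Galois action is trivial when `v ∈ 𝕍^arc`" = instantiate `Γ v`
  at a trivially acting monoid (`ofGaussianArch_ΨGal_eq_of_trivial`: then `ΨGal = Ψ`).

HONEST SCOPE: archimedean places are never bad ([IUTchI] Def. 3.1 (b),(c)), so the bad-place clauses of the
signature are vacuous there — they hold anyway because `𝓘^ℚ` is everything; the two fibres (this file, p422157)
are separate `LGPMonoidSignature`s over `Varc` and `Vfib ∣ p` (print's `𝕍 ∋ v ↦ …` ranges over all of `𝕍`; a
sigma-type repackaging is bookkeeping and is not done). No `Prop`-valued definition, no instance; nothing here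
asserts abc proved or refuted or takes a side on [IUTchIII] Cor. 3.12; typed ≠ discharged; instantiated ≠
endorsed.
-/

noncomputable section

namespace Literature.IUT.LogThetaLattice

open Set
open Literature.IUT.HodgeArakelov
open scoped TensorProduct
open PiTensorProduct

universe u v' w' w''

/-! ### 1. The generic component-push constructor -/

section Push

variable {lstar : ℕ} {V : Type v'} (isBad : V → Prop)
variable (R : V → Fin lstar → Type u) [∀ v j, CommRing (R v j)] [∀ v j, Algebra ℚ (R v j)]
variable (IQ : ∀ v j, Submodule ℚ (R v j))
variable (M : V → Type w') [∀ v, CommMonoid (M v)]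
variable (Γ : V → Type w'') [∀ v, Monoid (Γ v)] [∀ v, MulDistribMulAction (Γ v) (M v)]
variable (f : ∀ v (j : Fin lstar), M v →* R v j)

/-- "the component labeled `j`" (p. 103 l. 6, l. 14) of the entire LGP-monoid determined by `S ⊆ ∏_{F_l^⋇} M_v`,
for an arbitrary family of label-`j` pushes `f_{v,j} : M_v →* R_{v,j}`: the image `f_{v,j}(pr_j S)`. At
`f := lgpPush` this is `lgpComponent` (p422157). [cite: Mochizuki2012, Prop. 3.4 (ii) p.103]
[claim: Mochizuki2012, status: disputed] -/
def pushComponent (v : V) (S : Submonoid (Fin lstar → M v)) (j : Fin lstar) : Submonoid (R v j) :=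
  (S.map (Pi.evalMonoidHom (fun _ : Fin lstar => M v) j)).map (f v j)

omit [∀ v j, Algebra ℚ (R v j)] in
/-- Membership in a pushed component: `y = f_{v,j}(x_j)` for some `x ∈ S`. [cite: Mochizuki2012, Prop. 3.4 (ii) p.103]
[claim: Mochizuki2012, status: disputed] -/
theorem mem_pushComponent_iff (v : V) (S : Submonoid (Fin lstar → M v)) (j : Fin lstar) (y : R v j) :
    y ∈ pushComponent R M f v S j ↔ ∃ x ∈ S, f v j (x j) = y := by
  constructor
  · rintro ⟨_, ⟨x, hx, rfl⟩, rfl⟩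
    exact ⟨x, hx, rfl⟩
  · rintro ⟨x, hx, rfl⟩
    exact ⟨x j, ⟨x, hx, rfl⟩, rfl⟩

variable (gau gauInf : ∀ v, Submonoid (Fin lstar → M v))
variable (split : ∀ v, isBad v → Submonoid (Fin lstar → M v))

/-- **[IUTchIII] Prop. 3.4 (ii), GENERIC FORM of the construction**: over any label-`j` carriers `R v j` whose
`𝓘^ℚ v j` is the whole carrier (`hIQ`; PROVED for the nonarchimedean packets — `lgpShellQ_eq_top`, p422157 — and
for the archimedean Hermitian packets — `archLgpShellQ_eq_top` below), the output signature `LGPMonoidSignature`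
built from the †-side Gaussian data of [IUTchII] Cor. 4.6 (iv) (`gau`, `gauInf`, splitting `split ≤ gau` at bad
`v`, `G_v`-action `Γ v`) and the pushes `f v j` ("(i) at the label `j` applied to the pull-backs", p. 102
l. 31–37): `Ψ`/`ΨInf`/`ΨSplit` = pushed components, `ΨGal` = of the `Γ v`-fixed part, `ΨUnitsGal` = of the fixed
units; the four printed properties (p. 103 l. 5–24) PROVED. [cite: Mochizuki2012, Prop. 3.4 (ii) p.102]
[claim: Mochizuki2012, status: disputed] -/
def LGPMonoidSignature.ofPush (hIQ : ∀ v j, IQ v j = ⊤)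
    (split_le : ∀ v (h : isBad v), split v h ≤ gau v) : LGPMonoidSignature lstar V isBad R IQ where
  Ψ v j := pushComponent R M f v (gau v) j
  ΨInf v j := pushComponent R M f v (gauInf v) j
  ΨGal v j := pushComponent R M f v (gau v ⊓ galFixed M Γ v) j
  gal_le v j := Submonoid.monotone_map (Submonoid.monotone_map inf_le_left)
  ΨUnitsGal v j := pushComponent R M f v (unitsIn (gau v) ⊓ galFixed M Γ v) j
  unitsGal_le v j :=
    Submonoid.monotone_map (Submonoid.monotone_map (inf_le_inf_right _ (unitsIn_le (gau v))))
  ΨSplit v h j := pushComponent R M f v (split v h) j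
  split_le v h j := Submonoid.monotone_map (Submonoid.monotone_map (split_le v h))
  bad_gal_subset v _ j := by
    rw [hIQ, Submodule.top_coe]
    exact subset_univ _
  bad_gal_acts v _ j _ _ _ _ := by
    rw [hIQ]
    exact Submodule.mem_top
  unitsGal_subset v j := by
    rw [hIQ, Submodule.top_coe]
    exact subset_univ _
  unitsGal_acts v j _ _ _ _ := by
    rw [hIQ]
    exact Submodule.mem_top

variable (hIQ : ∀ v j, IQ v j = ⊤) (split_le : ∀ v (h : isBad v), split v h ≤ gau v)

/-- "this Galois action is trivial when `v ∈ 𝕍^arc`" (p. 103 l. 15–16): if `Γ v` acts trivially on `M_v`, the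
Galois-invariant components ARE the components. [cite: Mochizuki2012, Prop. 3.4 (ii) p.103]
[claim: Mochizuki2012, status: disputed] -/
theorem LGPMonoidSignature.ofPush_ΨGal_eq_of_trivial (v : V) (htriv : ∀ (g : Γ v) (x : M v), g • x = x)
    (j : Fin lstar) :
    (LGPMonoidSignature.ofPush isBad R IQ M Γ f gau gauInf split hIQ split_le).ΨGal v j =
      (LGPMonoidSignature.ofPush isBad R IQ M Γ f gau gauInf split hIQ split_le).Ψ v j := by
  have hfix : galFixed M Γ v = (⊤ : Submonoid (Fin lstar → M v)) := by
    refine eq_top_iff.mpr fun x _ => ?_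
    rw [galFixed, FixedPoints.mem_submonoid]
    intro g
    funext i
    exact htriv g (x i)
  change pushComponent R M f v (gau v ⊓ galFixed M Γ v) j = pushComponent R M f v (gau v) j
  rw [hfix, inf_top_eq]

end Push

/-! ### 1′. The nonarchimedean construction of p422157 is `ofPush` -/

section Nonarch

variable (p : ℕ) [Fact p.Prime] {Vfib : Type v'} [Fintype Vfib]
variable (K : Vfib → Type u) [∀ v, NontriviallyNormedField (K v)] [∀ v, Algebra ℚ_[p] (K v)]
  [∀ v, IsBoundedSMul ℚ_[p] (K v)] [∀ v, IsUltrametricDist (K v)] [∀ v, CharZero (K v)]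
variable (Lg : ∀ v, Literature.AnabelianGeometry.AbsoluteAnabelian.PadicLogOnUnits (K v))
variable {lstar : ℕ} (isBad : Vfib → Prop)
variable (M : Vfib → Type w') [∀ v, CommMonoid (M v)]
variable (Γ : Vfib → Type w'') [∀ v, Monoid (Γ v)] [∀ v, MulDistribMulAction (Γ v) (M v)]
variable (ι : ∀ v, M v →* K v)
variable (gau gauInf : ∀ v, Submonoid (Fin lstar → M v))
variable (split : ∀ v, isBad v → Submonoid (Fin lstar → M v))
variable (split_le : ∀ v (h : isBad v), split v h ≤ gau v)

/-- The nonarchimedean construction `LGPMonoidSignature.ofGaussian` (p422157) IS the generic `ofPush` at the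
pushes `lgpPush v j = toPacketAt_j ∘ ι_v` and `hIQ := lgpShellQ_eq_top` (definitionally).
[cite: Mochizuki2012, Prop. 3.4 (ii) p.102] [claim: Mochizuki2012, status: disputed] -/
theorem LGPMonoidSignature.ofGaussian_eq_ofPush :
    LGPMonoidSignature.ofGaussian p K Lg isBad M Γ ι gau gauInf split split_le =
      LGPMonoidSignature.ofPush isBad (fun v j => LGPPacket p K v j) (fun v j => lgpShellQ p K Lg v j) M Γ
        (lgpPush p K M ι) gau gauInf split (lgpShellQ_eq_top p K Lg) split_le :=
  rfl

end Nonarch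

/-! ### 2. At archimedean `v_ℚ`: the `ℚ`-span of the Hermitian unit ball is the whole packet -/

section HermitianSpan

variable {A V : Type} [Fintype A] [DecidableEq A] [Fintype V]

/-- **[IUTchIII] Prop. 3.2 (ii) p. 99, archimedean `v_ℚ` — "closed unit balls `𝓘(^{A,α}𝒟^⊢_v)` … integral structures
on the `ℚ`-spans `𝓘^ℚ(…)`", read LITERALLY: the `ℚ`-span of the Hermitian unit ball `hermitianBallAt A V r α v`
(abc-iut-w4-d039's genuine tensor-product Hermitian ball of radius `r`, `r = π` in print) is the WHOLE packet
`log(^{A,α}𝒟^⊢_v) = ℂ_v ⊗_ℝ (⊗_{β≠α} ⊕_w ℂ_w)`** (`r ≠ 0`): every `t` has `n⁻¹·t` in the ball for a natural number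
`n ≥ 1` (`B(n⁻¹t, n⁻¹t) = n⁻²·B(t,t)`, Archimedean property), and `t = n · (n⁻¹·t)` with `n ∈ ℚ`. PROVED.
[cite: Mochizuki2012, Prop. 3.2 (ii) p.99] [claim: Mochizuki2012, status: disputed] -/
theorem span_rat_hermitianBallAt_eq_top {r : ℝ} (hr : r ≠ 0) (α : A) (v : V) :
    Submodule.span ℚ (hermitianBallAt A V r α v) = ⊤ := by
  set W := Submodule.span ℚ (hermitianBallAt A V r α v) with hW
  rw [eq_top_iff]
  rintro t -
  set N : ℝ := (r ^ 2) ^ Fintype.card A with hN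
  have hNpos : 0 < N := pow_pos (pow_pos (abs_pos.mpr hr) 2 |>.trans_eq (sq_abs r)) _
  set a : ℝ := atForm A V α v t t with ha
  obtain ⟨n, hn⟩ := exists_nat_ge (max 1 (a / N))
  have hn1 : (1 : ℝ) ≤ n := (le_max_left _ _).trans hn
  have hn0 : (n : ℝ) ≠ 0 := by positivity
  have haN : a ≤ n * N := by
    have h := (le_max_right _ _).trans hn
    rwa [div_le_iff₀ hNpos] at h
  -- `n⁻¹ · t` lies in the ball
  have hball : ((n : ℝ)⁻¹ • t) ∈ hermitianBallAt A V r α v := by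
    change atForm A V α v ((n : ℝ)⁻¹ • t) ((n : ℝ)⁻¹ • t) ≤ (r ^ 2) ^ Fintype.card A
    rw [LinearMap.BilinForm.smul_left, LinearMap.BilinForm.smul_right, ← ha, ← hN]
    rcases le_or_gt a 0 with ha0 | ha0
    · calc (n : ℝ)⁻¹ * ((n : ℝ)⁻¹ * a) ≤ 0 :=
            mul_nonpos_of_nonneg_of_nonpos (by positivity)
              (mul_nonpos_of_nonneg_of_nonpos (by positivity) ha0)
        _ ≤ N := hNpos.le
    · have hinv1 : (n : ℝ)⁻¹ ≤ 1 := inv_le_one_of_one_le₀ hn1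
      calc (n : ℝ)⁻¹ * ((n : ℝ)⁻¹ * a) ≤ 1 * ((n : ℝ)⁻¹ * a) :=
            mul_le_mul_of_nonneg_right hinv1 (mul_nonneg (by positivity) ha0.le)
        _ = (n : ℝ)⁻¹ * a := one_mul _
        _ ≤ (n : ℝ)⁻¹ * (n * N) := mul_le_mul_of_nonneg_left haN (by positivity)
        _ = N := by rw [← mul_assoc, inv_mul_cancel₀ hn0, one_mul]
  have hmem : ((n : ℕ) : ℚ) • ((n : ℝ)⁻¹ • t) ∈ W := W.smul_mem _ (Submodule.subset_span hball)
  rwa [Nat.cast_smul_eq_nsmul ℚ, ← Nat.cast_smul_eq_nsmul ℝ, smul_smul, mul_inv_cancel₀ hn0, one_smul]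
    at hmem

end HermitianSpan

/-! ### 3. The archimedean fibre: `LGPMonoidSignature.ofGaussianArch` -/

section Arch

variable {Varc : Type} [Fintype Varc] {lstar : ℕ} (isBad : Varc → Prop)

/-- `log(^{S^±_{j+1},j;‡}𝓕_v)` at an ARCHIMEDEAN place `v` ([IUTchIII] Prop. 3.4 (ii) p. 103 l. 19; Prop. 3.1 (ii)): the
`(A, α)`-packet over `ℝ` with every `(j+1)`-capsule factor the ‡-local field `ℂ_w` (abc-iut-w4-d039's
`ArchComponents`, the carriers of the genuine Hermitian structures), `A := S^±_{j+1}`, `α :=` the label `j`.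
[cite: Mochizuki2012, Prop. 3.4 (ii) p.103] [claim: Mochizuki2012, status: disputed] -/
abbrev ArchLGPPacket (v : Varc) (j : Fin lstar) : Type :=
  PacketAt ℝ (ArchComponents (Fin (labelNat j + 1)) Varc) (Fin.last (labelNat j)) v

/-- The ring homomorphism `log(^j‡𝓕_v) = ℂ_v → log(^{S^±_{j+1},j;‡}𝓕_v)` "tensor with `1`'s" (Prop. 3.1 (ii), abc-iut-L6-t4's
`toPacketAt`) at the label `j`, archimedean place, as a monoid homomorphism.
[cite: Mochizuki2012, Prop. 3.1 (ii) p.93] [claim: Mochizuki2012, status: disputed] -/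
abbrev toArchLGPPacket (v : Varc) (j : Fin lstar) : ℂ →* ArchLGPPacket v j :=
  (toPacketAt ℝ (ArchComponents (Fin (labelNat j + 1)) Varc) (Fin.last (labelNat j)) v).toRingHom.toMonoidHom

/-- **`𝓘^ℚ(^{S^±_{j+1},j;‡}𝓕_v)` at an archimedean place** := "the `ℚ`-span" (Prop. 3.2 (ii) p. 99) of the Hermitian unit ball
`𝓘(^{S^±_{j+1},j;‡}𝒟^⊢_v)` of radius `r` (`hermitianBallAt`; `r = π` = the log-shell radius in print), LITERALLY.
[cite: Mochizuki2012, Prop. 3.2 (ii) p.99] [claim: Mochizuki2012, status: disputed] -/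
def archLgpShellQ (r : ℝ) (v : Varc) (j : Fin lstar) : Submodule ℚ (ArchLGPPacket v j) :=
  Submodule.span ℚ (hermitianBallAt (Fin (labelNat j + 1)) Varc r (Fin.last (labelNat j)) v)

/-- `𝓘^ℚ(^{S^±_{j+1},j;‡}𝓕_v)` at an archimedean place is the whole packet (`span_rat_hermitianBallAt_eq_top`), `r ≠ 0`.
[cite: Mochizuki2012, Prop. 3.2 (ii) p.99] [claim: Mochizuki2012, status: disputed] -/
theorem archLgpShellQ_eq_top {r : ℝ} (hr : r ≠ 0) (v : Varc) (j : Fin lstar) :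
    archLgpShellQ (lstar := lstar) r v j = ⊤ :=
  span_rat_hermitianBallAt_eq_top hr _ v

variable (M : Varc → Type w') [∀ v, CommMonoid (M v)]
variable (Γ : Varc → Type w'') [∀ v, Monoid (Γ v)] [∀ v, MulDistribMulAction (Γ v) (M v)]
variable (ι : ∀ v, M v →* ℂ)
variable (gau gauInf : ∀ v, Submonoid (Fin lstar → M v))
variable (split : ∀ v, isBad v → Submonoid (Fin lstar → M v))

/-- **[IUTchIII] Prop. 3.4 (ii) CONSTRUCTED AT THE ARCHIMEDEAN PLACES: `LGPMonoidSignature.ofGaussianArch`** — the output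
signature over the archimedean places `Varc`, carriers the real Hermitian label-`j` packets `ArchLGPPacket`,
`𝓘^ℚ := archLgpShellQ r` (the literal `ℚ`-span of the Hermitian unit ball of radius `r ≠ 0`, `r = π` in print),
built by `ofPush` from the †-side Gaussian data of [IUTchII] Prop. 4.4 (iv) / Cor. 4.6 (iv) at `v ∈ 𝕍^arc`
(`gau`, `gauInf` ⊆ `∏_{F_l^⋇} M_v`; `split` only enters at bad places, of which there are none archimedean)
pulled back along ONE member `ι v : M_v →* ℂ_v` of the log-link's poly-isomorphism (EXPLICIT PARAMETER) and
pushed by `toArchLGPPacket v j`. The printed unit-portion property p. 103 l. 14–24 is PROVED (`𝓘^ℚ` is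
everything). [cite: Mochizuki2012, Prop. 3.4 (ii) p.102] [claim: Mochizuki2012, status: disputed] -/
def LGPMonoidSignature.ofGaussianArch {r : ℝ} (hr : r ≠ 0) (split_le : ∀ v (h : isBad v), split v h ≤ gau v) :
    LGPMonoidSignature lstar Varc isBad (fun v j => ArchLGPPacket v j) (fun v j => archLgpShellQ r v j) :=
  LGPMonoidSignature.ofPush isBad (fun v j => ArchLGPPacket v j) (fun v j => archLgpShellQ r v j) M Γ
    (fun v j => (toArchLGPPacket v j).comp (ι v)) gau gauInf split
    (fun v j => archLgpShellQ_eq_top hr v j) split_le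

variable {r : ℝ} (hr : r ≠ 0) (split_le : ∀ v (h : isBad v), split v h ≤ gau v)

/-- Sub-DAG row r11 at an archimedean place: the `j`-component of the constructed LGP-monoid IS abc-iut-L6-t4's single
packet monoid (Prop. 3.4 (i), `singlePacketMonoid`) of the label-`j` component `ι_v(pr_j(Ψ_{𝓕gau}(†𝓗𝓣^Θ)_v)) ⊆ ℂ_v`.
[cite: Mochizuki2012, Prop. 3.4 (ii) p.102] [claim: Mochizuki2012, status: disputed] -/
theorem LGPMonoidSignature.ofGaussianArch_Ψ (v : Varc) (j : Fin lstar) :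
    (LGPMonoidSignature.ofGaussianArch isBad M Γ ι gau gauInf split hr split_le).Ψ v j =
      singlePacketMonoid (𝕜 := ℝ) (Lv := ℂ) (Pv := ArchLGPPacket v j)
        (toPacketAt ℝ (ArchComponents (Fin (labelNat j + 1)) Varc) (Fin.last (labelNat j)) v)
        (((gau v).map (Pi.evalMonoidHom (fun _ : Fin lstar => M v) j)).map (ι v)) := by
  change pushComponent (fun v j => ArchLGPPacket v j) M (fun v j => (toArchLGPPacket v j).comp (ι v)) v
    (gau v) j = _
  simp only [pushComponent, singlePacketMonoid, Submonoid.map_map]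
  ext y
  constructor
  · rintro ⟨x, hx, rfl⟩
    exact ⟨x, hx, rfl⟩
  · rintro ⟨x, hx, rfl⟩
    exact ⟨x, hx, rfl⟩

/-- "this Galois action is trivial when `v ∈ 𝕍^arc`" (p. 103 l. 15–16): for a trivially acting `Γ v` the invariant
components of the archimedean LGP-monoid are the components themselves. [cite: Mochizuki2012, Prop. 3.4 (ii) p.103]
[claim: Mochizuki2012, status: disputed] -/
theorem LGPMonoidSignature.ofGaussianArch_ΨGal_eq_of_trivial (v : Varc)
    (htriv : ∀ (g : Γ v) (x : M v), g • x = x) (j : Fin lstar) :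
    (LGPMonoidSignature.ofGaussianArch isBad M Γ ι gau gauInf split hr split_le).ΨGal v j =
      (LGPMonoidSignature.ofGaussianArch isBad M Γ ι gau gauInf split hr split_le).Ψ v j :=
by
  have hfix : galFixed M Γ v = (⊤ : Submonoid (Fin lstar → M v)) := by
    refine eq_top_iff.mpr fun x _ => ?_
    rw [galFixed, FixedPoints.mem_submonoid]
    intro g
    funext i
    exact htriv g (x i)
  change pushComponent (fun v j => ArchLGPPacket v j) M (fun v j => (toArchLGPPacket v j).comp (ι v)) v
      (gau v ⊓ galFixed M Γ v) j =
    pushComponent (fun v j => ArchLGPPacket v j) M (fun v j => (toArchLGPPacket v j).comp (ι v)) v (gau v) j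
  rw [hfix, inf_top_eq]

end Arch

end Literature.IUT.LogThetaLattice

end
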